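import Summits.HubbardSuperconductivity.HubbardSuperconductivity.Theorems.ThermalWedgeTwSourcedInertnessSusceptibility

/-!
# Crux `TwSourcedInertness` (item `stmt-HubbardSuperconductivity-1696`), line
`temperature-for-source-exchange`: the disc-correction stub follows from the pair-susceptibility bound

`--supports stmt-HubbardSuperconductivity-1696` file of the line lead; no definition is introduced.

The registered stub `stub_discCorrection` of the line's skeleton
(Cruxes/TwSourcedInertness/Lines/temperature_for_source_exchange.lean) bounds the INTERACTION
CORRECTION to the sourced pressure gain on the thermal disc,
`[p̃_U(h) − p̃_0(h)] − [p̃_U(0) − p̃_0(0)] ≤ C(1+log β)h²` for `|h| ≤ c/β`. Since the FREE gain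
`p̃_0(h) − p̃_0(0)` is `≥ 0` (Peierls–Bogoliubov plus `⟨Δ_d + Δ_d†⟩ = 0`, tree
`TwSourcedCondensation.Negative.pressure_response_nonneg`), the correction is bounded by the full
interacting gain, which the tree already controls by the Kubo–Mori–Bogoliubov `d`-wave PAIR
SUSCEPTIBILITY of the sourced torus Gibbs state (`tw_thermalDisc_of_discSusceptibility`, prover seat 2).
Hence `stub_discCorrection_of_discSusceptibility`: the textbook Fermi-liquid statement
"`χ_L(β,μ,U,t) = (β/L²)[Re (Q,Q)_{β,H_{L,t}} − (Re⟨Q⟩_{β,H_{L,t}})²] ≤ C(1+log β)` throughout the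
thermal disc `|t| ≤ 1/β`, `Q = Δ_d + Δ_d†`, for `0 < U ≤ U₀`, `1 ≤ β ≤ e^{a/U}`, `μ ∈ [μ₁,μ₂]`,
eventually in `L`" implies the stub VERBATIM with `c = 1` and the same `U₀, a, C`. Together with
`twSourcedInertness_of_corrections` (Theorems/ThermalWedgeTwSourcedInertnessCorrections) and
`stub_thermalCorrection_of_entropyDensityLaw` this pins the crux on exactly two interacting
Fermi-liquid laws at general filling — the `O(log β)` pair susceptibility on the thermal disc and the
`O(T(1+|log T|))` specific heat — the linear-response and free-energy sectors of a
Benfatto–Giuliani–Mastropietro-type expansion with `U log β ≤ a`, neither in print.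

Sources: F. J. Dyson, E. H. Lieb, B. Simon, J. Stat. Phys. 18 (1978) 335, §3 [DLS1978];
G. Benfatto, A. Giuliani, V. Mastropietro, Ann. Henri Poincaré 7 (2006) 809, Thm 1.1, Remark 2
[BenfattoGiulianiMastropietro2006].
-/

noncomputable section

namespace Summit.HubbardSuperconductivity.HubbardSuperconductivity.Theorems

open Matrix Finset Literature.MathematicalPhysics.QuantumLattice Literature.Probability.LatticeModels
open Summit.HubbardSuperconductivity.HubbardSuperconductivity.Theorems.TwSourcedCondensation.Negative

/-- **Pair-susceptibility bound on the thermal disc ⇒ the disc-correction stub** (registered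
sub-goal of crux item stmt-HubbardSuperconductivity-1696; `c = 1`, same `U₀, a, C`): the interaction
correction to the gain is at most the interacting gain (the free gain is `≥ 0`,
`pressure_response_nonneg`), which `tw_thermalDisc_of_discSusceptibility` bounds by `C(1+log β)h²`.
[cite: DLS1978, §3 eq. (5)] -/
theorem stub_discCorrection_of_discSusceptibility :
    (∀ μ₁ μ₂ : ℝ, -4 < μ₁ → μ₁ ≤ μ₂ → μ₂ < 0 → ∃ U₀ a C : ℝ, 0 < U₀ ∧ 0 < a ∧ 0 < C ∧ ∀ U : ℝ, 0 < U → U ≤ U₀ → ∀ β : ℝ, 1 ≤ β → β ≤ Real.exp (a / U) → ∀ μ ∈ Set.Icc μ₁ μ₂, ∃ L₀ : ℕ, ∀ (L : ℕ) [NeZero L], L₀ ≤ L → ∀ t : ℝ, |t| ≤ 1 / β → β / (L : ℝ) ^ 2 * ((Matrix.duhamel β (Literature.MathematicalPhysics.QuantumLattice.dWaveSourceTorus L U μ t) (Literature.MathematicalPhysics.QuantumLattice.pairField Literature.MathematicalPhysics.QuantumLattice.dWaveFormFactor L + (Literature.MathematicalPhysics.QuantumLattice.pairField Literature.MathematicalPhysics.QuantumLattice.dWaveFormFactor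 L)ᴴ) (Literature.MathematicalPhysics.QuantumLattice.pairField Literature.MathematicalPhysics.QuantumLattice.dWaveFormFactor L + (Literature.MathematicalPhysics.QuantumLattice.pairField Literature.MathematicalPhysics.QuantumLattice.dWaveFormFactor L)ᴴ)).re - (Matrix.gibbsState β (Literature.MathematicalPhysics.QuantumLattice.dWaveSourceTorus L U μ t) (Literature.MathematicalPhysics.QuantumLattice.pairField Literature.MathematicalPhysics.QuantumLattice.dWaveFormFactor L + (Literature.MathematicalPhysics.QuantumLattice.pairField Literature.MathematicalPhysics.QuantumLattice.dWaveFormFactor L)ᴴ)).re ^ 2) ≤ C * (1 + Real.log β)) → (∀ μ₁ μ₂ : ℝ, -4 < μ₁ → μ₁ ≤ μ₂ → μ₂ < 0 → ∃ U₀ a C c : ℝ, 0 < U₀ ∧ 0 < a ∧ 0 < C ∧ 0 < c ∧ ∀ U : ℝ, 0 < U → U ≤ U₀ → ∀ β : ℝ, 1 ≤ β → β ≤ Real.exp (a / U) → ∀ μ ∈ Set.Icc μ₁ μ₂, ∃ L₀ : ℕ, ∀ (L : ℕ) [NeZero L], L₀ ≤ L → ∀ h : ℝ, |h| ≤ c /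 β → (Real.log (Matrix.partitionFn β (Literature.MathematicalPhysics.QuantumLattice.dWaveSourceTorus L U μ h)).re / (β * (L : ℝ) ^ 2) - Real.log (Matrix.partitionFn β (Literature.MathematicalPhysics.QuantumLattice.dWaveSourceTorus L 0 μ h)).re / (β * (L : ℝ) ^ 2)) - (Real.log (Matrix.partitionFn β (Literature.MathematicalPhysics.QuantumLattice.dWaveSourceTorus L U μ 0)).re / (β * (L : ℝ) ^ 2) - Real.log (Matrix.partitionFn β (Literature.MathematicalPhysics.QuantumLattice.dWaveSourceTorus L 0 μ 0)).re / (β * (L : ℝ) ^ 2)) ≤ C * (1 + Real.log β) * h ^ 2) := by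
  intro H μ₁ μ₂ h4 h12 h0
  obtain ⟨U₀, a, C, hU₀, ha, hC, hmain⟩ := tw_thermalDisc_of_discSusceptibility H μ₁ μ₂ h4 h12 h0
  refine ⟨U₀, a, C, 1, hU₀, ha, hC, one_pos, fun U hU hUU₀ β hβ hβa μ hμ => ?_⟩
  obtain ⟨L₀, hL₀⟩ := hmain U hU hUU₀ β hβ hβa μ hμ
  refine ⟨L₀, fun L _ hL h hh => ?_⟩
  have h1 := hL₀ L hL h hh
  have h2 := pressure_response_nonneg L (by linarith : (0 : ℝ) ≤ β) 0 μ h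
  linarith

end Summit.HubbardSuperconductivity.HubbardSuperconductivity.Theorems
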